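import Literature.NumberTheory.EllipticCurves.HeegnerPointsConjugationClassProofs
import Summits.BirchSwinnertonDyer.BirchSwinnertonDyer.Theorems.SylvesterTwoHeegnerIndexLevelFixingOrbitFormW
import HarnessLib

/-!
# (W2-b) `stub_levelFixingSeven` — THE CLASS OF THE FRICKE PARTNER WITHOUT `gcd(N, D) = 1`:
# `[𝔞_Q] = [𝔞_{fricke N Q}] · [𝔫_Q]` under the primitivity of `(A/N, N, B)` alone, and the instance on Hu–Shu–Yin's
# tower (`N = 3⁵`, `D = −243(pn)²`, `3 ∣ gcd(N, D)`): `[fricke 243 Q_n] = [Q_n] · [𝔫ₙ]`, `[𝔫ₙ]² = 1 ≠ [𝔫ₙ]` on `p ≡ 25 (27)`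
# (crux `UpperOffV0HSYPlus`, stmt-BirchSwinnertonDyer-19804; route `SylvesterTwoHeegnerIndex`, rung K7t)

Cell `bsd-cm`, seat `bsd-cm-k7t-c2` g32 ((W2-b) seat of record).  Helper toward `stmt-BirchSwinnertonDyer-19804`
(`--supports … --as helper`).  THEOREMS ONLY (no definition, no named fact, no instance, no `sorry`).  Vocabulary: the tree's
class group `ClassGroup (QO Δ)` of the quadratic order of discriminant `Δ.D` with Cox's class map `classOf'` and the ideals
`fIdeal` (`Computability/Cryptography/HallgrenClassGroupOrder`, Cox Thm. 7.7), `heegnerForms`, `HeegnerForm.fricke N Q =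
(CN, −B, A/N)`.

WHY.  The seat memo `W2B-RECIPROCITY-k7t-c2-g32.md` v2 §4.4 (evidence #53 on the crux item) reduces the W-class `p ≡ 25 (27)`
of (W2-b) to: the decomposition involution `s` translates the singular moduli of the order `𝒪_{9pn}` by the 2-torsion class
`η* = [𝔫ₙ]` of the LEVEL IDEAL `𝔫ₙ = (243, nB, (A/243)·C)`, and `[fricke 243 Q_n] = [Q_n]·[𝔫ₙ]` (Gross's `w_N`-formula), so
that `s·j(τ_n) = j(τ_{fricke 243 Q_n}) = j(w₂₄₃ • τ_n)`.  The tree has the factorisation `[𝔞_Q] = [𝔞_{(A/N,B,CN)}]·[𝔫_Q]`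
(`classOf'_eq_mul_levelForm`, `fIdeal_mul_fIdeal_level`, Cox Lemma 3.2 / (3.7)) ONLY under «no prime of `N` divides `D`»,
which FAILS here (`3 ∣ D`).  That hypothesis enters the tree proof at exactly one point — the Bezout identity
`u·(A/N) + v·N + w·B = 1`, i.e. the primitivity of `(A/N, N, B)` — and for HSY's forms this primitivity holds because
`3 ∤ A/243` (`SylvesterTwoLevelFixingOrbit.three_not_dvd_sylvesterA_div`, p748618).  This file re-runs the tree proof under
the primitivity hypothesis and instantiates it:

* `fIdeal_mul_fIdeal_level_of_isPrimitive` (any `Δ`, `N`, Heegner form `Q`; hypothesis: `(A/N, N, B)` primitive) —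
  `𝔞_{(A/N, B, CN)} · 𝔞_{(N, B, AC/N)} = 𝔞_{(A, B, C)}` in `𝒪_D` (the tree proof verbatim, Bezout from the hypothesis);
* ★ `classOf'_eq_mul_levelForm_of_isPrimitive` — `[𝔞_Q] = [𝔞_{(A/N,B,CN)}]·[𝔫_Q]` given also that the two factor forms are
  primitive positive definite; `classOf'_fricke_mul_levelForm_of_isPrimitive` — `[fricke N Q]·[𝔫_Q] = [Q]`
  (`[𝔞_{(CN,−B,A/N)}] = [𝔞_{(A/N,B,CN)}]` by the swap `S`, `classOf'_swapS`);
* HSY instance (`p ≡ 1 (3)`, `n ≠ 0`, `3 ∤ n`, `gcd(n, C) = 1`; `Δ` any `NegDiscr` with `Δ.D = (9pn)²·(−3)`):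
  `isPrimitive_sylvester_divLevel_level_B` (`(A/243, 243, nB)` primitive), `isPosPrim_sylvester_divLevel`
  (`(A/243, nB, 243C)`), `isPosPrim_sylvester_levelForm` (`𝔫ₙ = (243, nB, (A/243)C)`), and ★ `classOf'_fricke_sylvester`:
  **`classOf' Δ (fricke 243 Q_n) * classOf' Δ 𝔫ₙ = classOf' Δ Q_n`**;
* the W-class at `n = 1` (`p ≡ 25 (27)`): ★ `classOf'_sylvester_levelForm_sq_eq_one` (`[𝔫₁]² = 1`: `243 ∣ B`, so
  `(243, B, c) ∼ (243, −B, c)` by the translation `T^{−B/243}`, and `[(a,−b,c)] = [(a,b,c)]⁻¹`) and ★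
  `classOf'_sylvester_levelForm_ne_one` (`[𝔫₁] ≠ 1` for `p ≥ 27`: `𝔫₁ ∼ (243, 243, (243+p²)/4)`, a REDUCED form other than the
  principal one, `classOf'_inj`).

With k-ty1 g16's translation law for orders (`apply_classJ_eq_classJ_mul_of_negDiscr`, `SingularModuliClassGroupActionOrder`)
and Cox Prop. 3.11 in the tree (`natCard_sq_eq_one_classGroup_QO`: `#Cl(𝒪_D)[2] = 2^{μ−1}`, here `2`), these are the class-group
inputs of the memo's route (4.1) on the W-class; the assembler is the sequel.  HONEST LABEL: no stub closed; nothing asserted on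
19804; X12.CMAtTwo NOT proved; BSD is proved for no curve.

## References
* D. A. Cox, *Primes of the form x² + ny²*, 2nd ed. (2013), §2.A Thm. 2.8, §3.A Lemma 3.2 / (3.7), Thm. 3.9, Lemma 3.10,
  Prop. 3.11, §7.B Thm. 7.7. [Cox2013]
* B. H. Gross, *Heegner points on `X₀(N)`* (1984), §I.1, §5 (`w_N (𝒪, 𝔫, [𝔞]) = (𝒪, 𝔫̄, [𝔞𝔫⁻¹])`). [Gross1984]
* Y. Hu, J. Shu, H. Yin, Trans. AMS 372 (2019) = arXiv:1708.05266, §2.2, §4.1. [HuShuYin2019]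
* Tree: `fIdeal_mul_fIdeal_level`, `classOf'_eq_mul_levelForm`, `classOf'_negB_fricke` (`HeegnerPointsConjugationClassProofs`);
  `classOf'_swapS`, `classOf'_eq`, `val_fUnit`, `omega_sub_mul_omega_sub`, `exists_bezout_of_isPrimitive`
  (`HallgrenClassGroupOrder`); `inv_classOf'_eq_classOf'_negForm`, `classOf'_eq_classOf'_iff_properEquiv`
  (`QuadraticFields/AmbiguousClassesOrder`); `classOf'_inj` (`HallgrenClassGroupOrderInj`).
-/

set_option autoImplicit false
-- the Summit-side namespace `Summit.BirchSwinnertonDyer.BirchSwinnertonDyer.…` (summit = problem) is mandated by D-0017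
set_option linter.dupNamespace false

noncomputable section

open scoped Classical nonZeroDivisors QuadraticAlgebra

namespace Summit.BirchSwinnertonDyer.BirchSwinnertonDyer.Theorems.SylvesterTwoLevelFixingClass

open Literature.Computability.Cryptography.Hallgren2005
open Literature.Computability.Cryptography.Hallgren2005.OrderCl
open Literature.Computability.Cryptography.Hallgren2005.FormComposition (kOf mOf norm_eq four_mul_mOf)
open Literature.NumberTheory.QuadraticFields.Quadratic
open Literature.NumberTheory.EllipticCurves Literature.NumberTheory.EllipticCurves.HeegnerForm
  Literature.NumberTheory.EllipticCurves.HuShuYin2019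

variable (Δ : NegDiscr) {N : ℕ}

/-! ## §1 The concordant composition `𝔞_{(A/N,B,CN)} · 𝔫_Q = 𝔞_Q` under the primitivity of `(A/N, N, B)` -/

/-- A Heegner form of level `N` and discriminant `D` is a primitive positive definite `BinQF` of discriminant `D`. [folklore] -/
private theorem isPosPrim_of_mem_heegnerForms' {D : ℤ} {Q : ℤ × ℤ × ℤ} (hQ : Q ∈ heegnerForms N D) :
    (⟨Q.1, Q.2.1, Q.2.2⟩ : BinQF).IsPosPrim D :=
  ⟨hQ.1, hQ.2.1, (BinQF.isPrimitive_iff _).mpr hQ.2.2.2⟩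

/-- **`𝔞_{(A/N, B, CN)} · 𝔞_{(N, B, AC/N)} = 𝔞_{(A, B, C)}`** in `𝒪_D` for a Heegner form `Q = (A, B, C)` of level `N`, under the
primitivity of `(A/N, N, B)` ALONE (the tree's `fIdeal_mul_fIdeal_level` assumes «no prime of `N` divides `D`», used only to
produce this Bezout identity) — Cox's concordant composition `[a, ω−k]·[a', ω−k] = [aa', ω−k]`.
[cite: Cox2013, §3.A Lemma 3.2 / (3.7) with §7.B Thm. 7.7] -/
theorem fIdeal_mul_fIdeal_level_of_isPrimitive [NeZero N] {Q : ℤ × ℤ × ℤ} (hQ : Q ∈ heegnerForms N Δ.D)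
    (hp : (⟨Q.1 / N, (N : ℤ), Q.2.1⟩ : BinQF).IsPrimitive) :
    fIdeal Δ ⟨Q.1 / N, Q.2.1, Q.2.2 * N⟩ * fIdeal Δ ⟨(N : ℤ), Q.2.1, Q.1 / N * Q.2.2⟩ =
      fIdeal Δ ⟨Q.1, Q.2.1, Q.2.2⟩ := by
  have hfQ := isPosPrim_of_mem_heegnerForms' hQ
  obtain ⟨hdisc, hA, hNA, hprim⟩ := hQ
  -- the common `k` and `θ = ω − k`
  have hk₁ : kOf Δ.D ⟨Q.1 / N, Q.2.1, Q.2.2 * N⟩ = kOf Δ.D ⟨Q.1, Q.2.1, Q.2.2⟩ := rfl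
  have hk₂ : kOf Δ.D ⟨(N : ℤ), Q.2.1, Q.1 / N * Q.2.2⟩ = kOf Δ.D ⟨Q.1, Q.2.1, Q.2.2⟩ := rfl
  simp only [fIdeal, hk₁, hk₂]
  set θ : QO Δ := ω - (kOf Δ.D ⟨Q.1, Q.2.1, Q.2.2⟩ : QO Δ) with hθ
  -- `θ (θ + B) = −AC`
  have hθθ : θ * θ = -((Q.1 : QO Δ) * (Q.2.2 : QO Δ)) - (Q.2.1 : QO Δ) * θ := by
    have h1 := omega_sub_mul_omega_sub (Δ := Δ) hfQ
    have h2 := omega_sub_neg_eq (Δ := Δ) hfQ.disc_eq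
    rw [h2] at h1
    change θ * (θ + (Q.2.1 : QO Δ)) = -(((Q.1 * Q.2.2 : ℤ) : QO Δ)) at h1
    push_cast at h1
    linear_combination h1
  -- `(A/N) · N = A`
  have hAN : ((Q.1 / N : ℤ) : QO Δ) * (N : QO Δ) = (Q.1 : QO Δ) := by
    have := congrArg (fun z : ℤ ↦ (z : QO Δ)) (Int.ediv_mul_cancel hNA)
    push_cast at this
    exact this
  -- Bezout for `gcd(A/N, N, B) = 1`
  obtain ⟨u, v, w, huvw⟩ : ∃ u v w : ℤ, u * (Q.1 / N) + v * N + w * Q.2.1 = 1 := by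
    obtain ⟨u, v, w, h⟩ := exists_bezout_of_isPrimitive hp
    exact ⟨u, v, w, h⟩
  have hc : (u : QO Δ) * ((Q.1 / N : ℤ) : QO Δ) + (v : QO Δ) * (N : QO Δ) + (w : QO Δ) * (Q.2.1 : QO Δ) = 1 := by
    have := congrArg (fun z : ℤ ↦ (z : QO Δ)) huvw
    push_cast at this
    exact this
  rw [Ideal.span_pair_mul_span_pair]
  push_cast
  rw [hAN]
  apply le_antisymm
  · rw [Ideal.span_le]
    rintro z hz
    simp only [Set.mem_insert_iff, Set.mem_singleton_iff] at hz
    rcases hz with rfl | rfl | rfl | rfl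
    · exact Ideal.subset_span (by simp)
    · exact Ideal.mul_mem_left _ _ (Ideal.subset_span (by simp))
    · exact Ideal.mul_mem_right _ _ (Ideal.subset_span (by simp))
    · exact Ideal.mul_mem_left _ _ (Ideal.subset_span (by simp))
  · rw [Ideal.span_le]
    rintro z hz
    simp only [Set.mem_insert_iff, Set.mem_singleton_iff] at hz
    rcases hz with rfl | rfl
    · exact Ideal.subset_span (by simp)
    · -- `θ = u (A/N) θ + v N θ + w B θ` and `B θ = −θ² − A C`
      set I : Ideal (QO Δ) := Ideal.span {(Q.1 : QO Δ), ((Q.1 / N : ℤ) : QO Δ) * θ, θ * (N : QO Δ), θ * θ}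
        with hI
      have hA_mem : (Q.1 : QO Δ) ∈ I := Ideal.subset_span (by simp)
      have h1 : ((Q.1 / N : ℤ) : QO Δ) * θ ∈ I := Ideal.subset_span (by simp)
      have h2 : θ * (N : QO Δ) ∈ I := Ideal.subset_span (by simp)
      have h3 : θ * θ ∈ I := Ideal.subset_span (by simp)
      have hB : (Q.2.1 : QO Δ) * θ ∈ I := by
        have : (Q.2.1 : QO Δ) * θ = -(θ * θ) - (Q.2.2 : QO Δ) * (Q.1 : QO Δ) := by
          linear_combination hθθ
        rw [this]
        exact I.sub_mem (I.neg_mem h3) (I.mul_mem_left _ hA_mem)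
      have hθ_eq : θ = (u : QO Δ) * (((Q.1 / N : ℤ) : QO Δ) * θ) + (v : QO Δ) * (θ * (N : QO Δ)) +
          (w : QO Δ) * ((Q.2.1 : QO Δ) * θ) := by
        linear_combination -(θ * hc)
      rw [hθ_eq]
      exact Ideal.add_mem _ (Ideal.add_mem _ (Ideal.mul_mem_left _ _ h1) (Ideal.mul_mem_left _ _ h2))
        (Ideal.mul_mem_left _ _ hB)

/-- ★ **`[𝔞_Q] = [𝔞_{(A/N, B, CN)}] · [𝔫_Q]` in `Cl(𝒪_D)` WITHOUT `gcd(N, D) = 1`**: for a Heegner form `Q` of level `N`, given the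
primitivity of `(A/N, N, B)` and that the two factor forms `(A/N, B, CN)`, `𝔫_Q = (N, B, (A/N)C)` are primitive positive
definite of discriminant `D`. [cite: Cox2013, §3.A Lemma 3.2 / (3.7) with §7.B Thm. 7.7] -/
theorem classOf'_eq_mul_levelForm_of_isPrimitive [NeZero N] {Q : ℤ × ℤ × ℤ} (hQ : Q ∈ heegnerForms N Δ.D)
    (hp : (⟨Q.1 / N, (N : ℤ), Q.2.1⟩ : BinQF).IsPrimitive)
    (h₁ : (⟨Q.1 / N, Q.2.1, Q.2.2 * N⟩ : BinQF).IsPosPrim Δ.D)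
    (hn : (⟨(N : ℤ), Q.2.1, Q.1 / N * Q.2.2⟩ : BinQF).IsPosPrim Δ.D) :
    classOf' Δ ⟨Q.1, Q.2.1, Q.2.2⟩ =
      classOf' Δ ⟨Q.1 / N, Q.2.1, Q.2.2 * N⟩ * classOf' Δ ⟨(N : ℤ), Q.2.1, Q.1 / N * Q.2.2⟩ := by
  have hF := isPosPrim_of_mem_heegnerForms' hQ
  rw [classOf'_eq Δ hF, classOf'_eq Δ h₁, classOf'_eq Δ hn, ← map_mul]
  congr 1
  apply Units.ext
  rw [Units.val_mul, val_fUnit, val_fUnit, val_fUnit, ← FractionalIdeal.coeIdeal_mul,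
    fIdeal_mul_fIdeal_level_of_isPrimitive Δ hQ hp]

/-- ★ **`[fricke N Q] · [𝔫_Q] = [Q]`**: the class of the Fricke partner `(CN, −B, A/N)` equals that of `(A/N, B, CN)` (the swap
`S`, `classOf'_swapS`), hence Gross's `w_N`-formula `[𝔞_{fricke Q}] = [𝔞_Q]·[𝔫_Q]⁻¹` — here under the three primitivity
hypotheses only. [cite: Gross1984, §5 (w_N on (𝒪, 𝔫, [𝔞]))] [cite: Cox2013, §3.A Lemma 3.2 with §7.B Thm. 7.7] -/
theorem classOf'_fricke_mul_levelForm_of_isPrimitive [NeZero N] {Q : ℤ × ℤ × ℤ} (hQ : Q ∈ heegnerForms N Δ.D)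
    (hp : (⟨Q.1 / N, (N : ℤ), Q.2.1⟩ : BinQF).IsPrimitive)
    (h₁ : (⟨Q.1 / N, Q.2.1, Q.2.2 * N⟩ : BinQF).IsPosPrim Δ.D)
    (hn : (⟨(N : ℤ), Q.2.1, Q.1 / N * Q.2.2⟩ : BinQF).IsPosPrim Δ.D) :
    classOf' Δ ⟨(fricke N Q).1, (fricke N Q).2.1, (fricke N Q).2.2⟩ * classOf' Δ ⟨(N : ℤ), Q.2.1, Q.1 / N * Q.2.2⟩ =
      classOf' Δ ⟨Q.1, Q.2.1, Q.2.2⟩ := by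
  have hfr : (⟨Q.2.2 * N, -Q.2.1, Q.1 / N⟩ : BinQF).IsPosPrim Δ.D := by
    have h := (BinQF.properEquiv_S (⟨Q.1 / N, Q.2.1, Q.2.2 * N⟩ : BinQF)).isPosPrim Δ.neg h₁
    exact h
  have hswap : classOf' Δ ⟨Q.1 / N, Q.2.1, Q.2.2 * N⟩ = classOf' Δ ⟨Q.2.2 * N, -Q.2.1, Q.1 / N⟩ := by
    have h := classOf'_swapS Δ hfr
    simpa only [Reduction.swapS, neg_neg] using h
  simp only [fricke_fst, fricke_snd_fst, fricke_snd_snd]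
  rw [← hswap, ← classOf'_eq_mul_levelForm_of_isPrimitive Δ hQ hp h₁ hn]

/-! ## §2 The instance on Hu–Shu–Yin's tower: `Q_n = (n²A, nB, C)`, `N = 243`, `D = (9pn)²·(−3)` -/

/-- `(A/243, 243, nB)` is primitive: `3 ∤ A/243` (`three_not_dvd_sylvesterA_div`), and a common divisor divides `243 = 3⁵`.
[cite: HuShuYin2019, §4.1 (p. 10)] -/
theorem isPrimitive_sylvester_divLevel_level_B {p n : ℕ} (hp : p % 3 = 1) (hn3 : ¬ 3 ∣ n) :
    (⟨(n : ℤ) ^ 2 * (81 * ((p : ℤ) ^ 2 + 4 * p + 16)) / 243, ((243 : ℕ) : ℤ),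
        (n : ℤ) * (-(9 * (4 * (p : ℤ) ^ 2 + 17 * p + 72)))⟩ : BinQF).IsPrimitive := by
  rw [BinQF.isPrimitive_iff]
  intro d hd₁ hd₂ _
  by_contra hd
  obtain ⟨q, hq, hqd⟩ := Int.exists_prime_and_dvd (fun h ↦ hd (Int.isUnit_iff_natAbs_eq.mpr h))
  have h243 : q ∣ (3 : ℤ) ^ 5 := by
    have h : q ∣ ((243 : ℕ) : ℤ) := hqd.trans hd₂
    norm_num at h ⊢
    exact h
  have hq3 : q ∣ 3 := hq.dvd_of_dvd_pow h243
  have hassoc : Associated q 3 := hq.associated_of_dvd Int.prime_three hq3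
  exact SylvesterTwoLevelFixingOrbit.three_not_dvd_sylvesterA_div hp hn3 (hassoc.symm.dvd.trans (hqd.trans hd₁))

/-- `(A/243, nB, 243C)` is primitive positive definite of discriminant `(9pn)²·(−3)`: it is `S` applied to the Fricke partner
`(243C, −nB, A/243)`, a Heegner form (`fricke_sylvesterForm_mem_heegnerForms`, p748618). [cite: HuShuYin2019, §4.1 (p. 10)] -/
theorem isPosPrim_sylvester_divLevel {p n : ℕ} (hp : p % 3 = 1) (hn : n ≠ 0) (hn3 : ¬ 3 ∣ n)
    (hnC : IsCoprime (n : ℤ) (4 * (p : ℤ) ^ 2 + 18 * p + 81)) :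
    (⟨(n : ℤ) ^ 2 * (81 * ((p : ℤ) ^ 2 + 4 * p + 16)) / 243, (n : ℤ) * (-(9 * (4 * (p : ℤ) ^ 2 + 17 * p + 72))),
        (4 * (p : ℤ) ^ 2 + 18 * p + 81) * 243⟩ : BinQF).IsPosPrim (((9 * p * n : ℕ) : ℤ) ^ 2 * (-3)) := by
  have hfr := SylvesterTwoLevelFixingOrbit.fricke_sylvesterForm_mem_heegnerForms hp hn hn3 hnC
  have hfr' : (⟨(4 * (p : ℤ) ^ 2 + 18 * p + 81) * 243, -((n : ℤ) * (-(9 * (4 * (p : ℤ) ^ 2 + 17 * p + 72)))),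
      (n : ℤ) ^ 2 * (81 * ((p : ℤ) ^ 2 + 4 * p + 16)) / 243⟩ : BinQF).IsPosPrim (((9 * p * n : ℕ) : ℤ) ^ 2 * (-3)) :=
    ⟨hfr.1, hfr.2.1, (BinQF.isPrimitive_iff _).mpr hfr.2.2.2⟩
  have hD : ((9 * p * n : ℕ) : ℤ) ^ 2 * (-3) < 0 := by
    have hfd := hfr.1
    have hA := hfr.2.1
    -- discriminant of a positive definite form with `A > 0` (`disc = B² − 4AC`, `C > 0` not needed: use the tree lemma)
    simp only [fricke_fst, fricke_snd_fst, fricke_snd_snd] at hfd hA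
    have h9 : (0 : ℤ) < ((9 * p * n : ℕ) : ℤ) := by
      have hp0 : 0 < p := by omega
      exact_mod_cast Nat.mul_pos (Nat.mul_pos (by norm_num) hp0) (Nat.pos_of_ne_zero hn)
    nlinarith
  have h := (BinQF.properEquiv_S _).isPosPrim hD hfr'
  simpa only [neg_neg] using h

/-- **The level form `𝔫ₙ = (243, nB, (A/243)·C)` is primitive positive definite of discriminant `(9pn)²·(−3)`**: discriminant
from `243·(A/243) = A`; primitivity because a common divisor divides `243` while `3 ∤ (A/243)·C` (`3 ∤ A/243`, `3 ∤ C`).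
[cite: Gross1984, §I.1 (the ideal 𝔫 with 𝒪/𝔫 ≅ ℤ/N)] [cite: HuShuYin2019, §4.1 (p. 10)] -/
theorem isPosPrim_sylvester_levelForm {p n : ℕ} (hp : p % 3 = 1) (hn : n ≠ 0) (hn3 : ¬ 3 ∣ n)
    (hnC : IsCoprime (n : ℤ) (4 * (p : ℤ) ^ 2 + 18 * p + 81)) :
    (⟨((243 : ℕ) : ℤ), (n : ℤ) * (-(9 * (4 * (p : ℤ) ^ 2 + 17 * p + 72))),
        (n : ℤ) ^ 2 * (81 * ((p : ℤ) ^ 2 + 4 * p + 16)) / 243 * (4 * (p : ℤ) ^ 2 + 18 * p + 81)⟩ : BinQF).IsPosPrim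
      (((9 * p * n : ℕ) : ℤ) ^ 2 * (-3)) := by
  obtain ⟨hdisc, hA, hNA, -⟩ := sylvesterForm_mem_heegnerForms hp hn hnC
  have hNA' : (243 : ℤ) ∣ (n : ℤ) ^ 2 * (81 * ((p : ℤ) ^ 2 + 4 * p + 16)) := hNA
  refine ⟨?_, by show (0 : ℤ) < ((243 : ℕ) : ℤ); norm_num, ?_⟩
  · show ((n : ℤ) * (-(9 * (4 * (p : ℤ) ^ 2 + 17 * p + 72)))) ^ 2 -
        4 * (((243 : ℕ) : ℤ)) * ((n : ℤ) ^ 2 * (81 * ((p : ℤ) ^ 2 + 4 * p + 16)) / 243 * (4 * (p : ℤ) ^ 2 + 18 * p + 81)) =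
      ((9 * p * n : ℕ) : ℤ) ^ 2 * (-3)
    have hdisc' : ((n : ℤ) * (-(9 * (4 * (p : ℤ) ^ 2 + 17 * p + 72)))) ^ 2 -
        4 * ((n : ℤ) ^ 2 * (81 * ((p : ℤ) ^ 2 + 4 * p + 16))) * (4 * (p : ℤ) ^ 2 + 18 * p + 81) =
        ((9 * p * n : ℕ) : ℤ) ^ 2 * (-3) := hdisc
    rw [← hdisc', show (4 : ℤ) * ((243 : ℕ) : ℤ) * ((n : ℤ) ^ 2 * (81 * ((p : ℤ) ^ 2 + 4 * p + 16)) / 243 *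
        (4 * (p : ℤ) ^ 2 + 18 * p + 81)) =
        4 * ((n : ℤ) ^ 2 * (81 * ((p : ℤ) ^ 2 + 4 * p + 16)) / 243 * 243) * (4 * (p : ℤ) ^ 2 + 18 * p + 81) by
          push_cast; ring, Int.ediv_mul_cancel hNA']
  · rw [BinQF.isPrimitive_iff]
    intro d hd₁ _ hd₃
    by_contra hd
    obtain ⟨q, hq, hqd⟩ := Int.exists_prime_and_dvd (fun h ↦ hd (Int.isUnit_iff_natAbs_eq.mpr h))
    have h243 : q ∣ (3 : ℤ) ^ 5 := by
      have h : q ∣ ((243 : ℕ) : ℤ) := hqd.trans hd₁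
      norm_num at h ⊢
      exact h
    have hassoc : Associated q 3 := hq.associated_of_dvd Int.prime_three (hq.dvd_of_dvd_pow h243)
    have h3 : (3 : ℤ) ∣ (n : ℤ) ^ 2 * (81 * ((p : ℤ) ^ 2 + 4 * p + 16)) / 243 * (4 * (p : ℤ) ^ 2 + 18 * p + 81) :=
      hassoc.symm.dvd.trans (hqd.trans hd₃)
    rcases Int.prime_three.dvd_or_dvd h3 with h | h
    · exact SylvesterTwoLevelFixingOrbit.three_not_dvd_sylvesterA_div hp hn3 h
    · exact three_not_dvd_C hp h

/-- ★ **`[fricke 243 Q_n] · [𝔫ₙ] = [Q_n]` on Hu–Shu–Yin's tower** (every `p ≡ 1 (3)`, `n ≥ 1` with `3 ∤ n`, `gcd(n, C) = 1`; `Δ` any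
negative discriminant datum with `Δ.D = (9pn)²·(−3)`): Gross's `w_N`-formula for the CM points of conductor `9pn` on `X₀(3⁵)`,
although `3 ∣ gcd(N, D)`. [cite: Gross1984, §5] [cite: Cox2013, §3.A Lemma 3.2 with §7.B Thm. 7.7] [cite: HuShuYin2019, §4.1] -/
theorem classOf'_fricke_sylvester {p n : ℕ} (hp : p % 3 = 1) (hn : n ≠ 0) (hn3 : ¬ 3 ∣ n)
    (hnC : IsCoprime (n : ℤ) (4 * (p : ℤ) ^ 2 + 18 * p + 81)) (hΔ : Δ.D = ((9 * p * n : ℕ) : ℤ) ^ 2 * (-3)) :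
    classOf' Δ ⟨(fricke 243 ((n : ℤ) ^ 2 * (81 * ((p : ℤ) ^ 2 + 4 * p + 16)),
        (n : ℤ) * (-(9 * (4 * (p : ℤ) ^ 2 + 17 * p + 72))), 4 * (p : ℤ) ^ 2 + 18 * p + 81)).1,
      (fricke 243 ((n : ℤ) ^ 2 * (81 * ((p : ℤ) ^ 2 + 4 * p + 16)),
        (n : ℤ) * (-(9 * (4 * (p : ℤ) ^ 2 + 17 * p + 72))), 4 * (p : ℤ) ^ 2 + 18 * p + 81)).2.1,
      (fricke 243 ((n : ℤ) ^ 2 * (81 * ((p : ℤ) ^ 2 + 4 * p + 16)),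
        (n : ℤ) * (-(9 * (4 * (p : ℤ) ^ 2 + 17 * p + 72))), 4 * (p : ℤ) ^ 2 + 18 * p + 81)).2.2⟩ *
      classOf' Δ ⟨((243 : ℕ) : ℤ), (n : ℤ) * (-(9 * (4 * (p : ℤ) ^ 2 + 17 * p + 72))),
        (n : ℤ) ^ 2 * (81 * ((p : ℤ) ^ 2 + 4 * p + 16)) / 243 * (4 * (p : ℤ) ^ 2 + 18 * p + 81)⟩ =
      classOf' Δ ⟨(n : ℤ) ^ 2 * (81 * ((p : ℤ) ^ 2 + 4 * p + 16)),
        (n : ℤ) * (-(9 * (4 * (p : ℤ) ^ 2 + 17 * p + 72))), 4 * (p : ℤ) ^ 2 + 18 * p + 81⟩ := by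
  have hQ : ((n : ℤ) ^ 2 * (81 * ((p : ℤ) ^ 2 + 4 * p + 16)), (n : ℤ) * (-(9 * (4 * (p : ℤ) ^ 2 + 17 * p + 72))),
      4 * (p : ℤ) ^ 2 + 18 * p + 81) ∈ heegnerForms 243 Δ.D := by
    rw [hΔ]; exact sylvesterForm_mem_heegnerForms hp hn hnC
  have hp' := isPrimitive_sylvester_divLevel_level_B (p := p) (n := n) hp hn3
  have h₁ := isPosPrim_sylvester_divLevel hp hn hn3 hnC
  have hn' := isPosPrim_sylvester_levelForm hp hn hn3 hnC
  rw [← hΔ] at h₁ hn'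
  exact classOf'_fricke_mul_levelForm_of_isPrimitive Δ (N := 243) hQ hp' h₁ hn'

/-! ## §3 The W-class at `n = 1`: `[𝔫₁]² = 1 ≠ [𝔫₁]` for `p ≡ 25 (mod 27)` -/

/-- ★ **`[𝔫₁]² = 1` on the class `p ≡ 25 (mod 27)`**: `243 ∣ B` (as `27 ∣ 4p²+17p+72`), so the translation `T^{k}`, `B = −243k`,
carries `(243, B, c)` to its opposite `(243, −B, c)`, whose class is the inverse. [cite: Cox2013, §3.A Thm. 3.9, Lemma 3.10] -/
theorem classOf'_sylvester_levelForm_sq_eq_one {p : ℕ} (hp : p % 27 = 25) {c : ℤ}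
    (hn : (⟨((243 : ℕ) : ℤ), ((1 : ℕ) : ℤ) * (-(9 * (4 * (p : ℤ) ^ 2 + 17 * p + 72))), c⟩ : BinQF).IsPosPrim Δ.D) :
    classOf' Δ ⟨((243 : ℕ) : ℤ), ((1 : ℕ) : ℤ) * (-(9 * (4 * (p : ℤ) ^ 2 + 17 * p + 72))), c⟩ ^ 2 = 1 := by
  obtain ⟨s, rfl⟩ : ∃ s : ℕ, p = 27 * s + 25 := ⟨p / 27, by omega⟩
  set B : ℤ := ((1 : ℕ) : ℤ) * (-(9 * (4 * ((27 * s + 25 : ℕ) : ℤ) ^ 2 + 17 * ((27 * s + 25 : ℕ) : ℤ) + 72))) with hB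
  -- `B = −243·k`
  have hBk : B = -243 * (108 * (s : ℤ) ^ 2 + 217 * s + 111) := by rw [hB]; push_cast; ring
  -- the translate `T^{k}` of `(243, B, c)` is the opposite form `(243, −B, c)`
  have hT := BinQF.properEquiv_T (⟨((243 : ℕ) : ℤ), B, c⟩ : BinQF) (108 * (s : ℤ) ^ 2 + 217 * s + 111)
  have hform : (⟨((243 : ℕ) : ℤ), B + 2 * ((243 : ℕ) : ℤ) * (108 * (s : ℤ) ^ 2 + 217 * s + 111),
      ((243 : ℕ) : ℤ) * (108 * (s : ℤ) ^ 2 + 217 * s + 111) ^ 2 + B * (108 * (s : ℤ) ^ 2 + 217 * s + 111) + c⟩ : BinQF) =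
      negForm ⟨((243 : ℕ) : ℤ), B, c⟩ := by
    simp only [negForm, BinQF.mk.injEq]
    refine ⟨trivial, ?_, ?_⟩
    · rw [hBk]; push_cast; ring
    · rw [hBk]; push_cast; ring
  have hT' : (⟨((243 : ℕ) : ℤ), B, c⟩ : BinQF).ProperEquiv (negForm ⟨((243 : ℕ) : ℤ), B, c⟩) := by
    have h := hT
    simp only at h
    rw [hform] at h
    exact h
  have hcl : classOf' Δ ⟨((243 : ℕ) : ℤ), B, c⟩ = classOf' Δ (negForm ⟨((243 : ℕ) : ℤ), B, c⟩) :=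
    (classOf'_eq_classOf'_iff_properEquiv Δ hn (isPosPrim_negForm hn)).mpr hT'
  rw [← inv_classOf'_eq_classOf'_negForm Δ hn] at hcl
  rw [sq, mul_eq_one_iff_eq_inv]
  exact hcl

/-- ★ **`[𝔫₁] ≠ 1` on the class `p ≡ 25 (mod 27)`, `p` odd, `p ≥ 27`**: `𝔫₁ = (243, B, c)` is properly equivalent (a translate) to the
REDUCED form `(243, 243, (243 + p²)/4)` (reduced since `243 ≤ (243+p²)/4` for `p ≥ 27`), which is not the principal reduced form
`(1, ·, ·)`; reduced forms determine their classes (`classOf'_inj`, Cox Thm. 2.8). [cite: Cox2013, §2.A Thm. 2.8, §7.B Thm. 7.7 (ii)] -/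
theorem classOf'_sylvester_levelForm_ne_one {p : ℕ} (hp : p % 27 = 25) (hp27 : 27 ≤ p) (hodd : p % 2 = 1)
    (hΔ : Δ.D = ((9 * p * 1 : ℕ) : ℤ) ^ 2 * (-3)) {c : ℤ}
    (hn : (⟨((243 : ℕ) : ℤ), ((1 : ℕ) : ℤ) * (-(9 * (4 * (p : ℤ) ^ 2 + 17 * p + 72))), c⟩ : BinQF).IsPosPrim Δ.D) :
    classOf' Δ ⟨((243 : ℕ) : ℤ), ((1 : ℕ) : ℤ) * (-(9 * (4 * (p : ℤ) ^ 2 + 17 * p + 72))), c⟩ ≠ 1 := by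
  obtain ⟨t, ht⟩ : ∃ t : ℕ, p = 54 * t + 25 := ⟨p / 54, by omega⟩
  subst ht
  have ht1 : 1 ≤ t := by omega
  set B : ℤ := ((1 : ℕ) : ℤ) * (-(9 * (4 * ((54 * t + 25 : ℕ) : ℤ) ^ 2 + 17 * ((54 * t + 25 : ℕ) : ℤ) + 72))) with hB
  -- `B = −243·(2j+1)`, `j = 216t² + 217t + 55`
  have hBj : B = -243 * (2 * (216 * (t : ℤ) ^ 2 + 217 * t + 55) + 1) := by rw [hB]; push_cast; ring
  have hdisc : B ^ 2 - 4 * ((243 : ℕ) : ℤ) * c = ((9 * (54 * t + 25) * 1 : ℕ) : ℤ) ^ 2 * (-3) := by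
    rw [← hΔ]; exact hn.disc_eq
  -- `c = c' + 243·j(j+1)` with the reduced representative `(243, 243, c')`, `c' = (243 + p²)/4 = 729t² + 675t + 217`
  have hc_eq : c = (729 * (t : ℤ) ^ 2 + 675 * t + 217) +
      243 * (216 * (t : ℤ) ^ 2 + 217 * t + 55) * ((216 * (t : ℤ) ^ 2 + 217 * t + 55) + 1) := by
    have h4 := hdisc
    rw [hBj] at h4
    push_cast at h4
    apply mul_left_cancel₀ (show (972 : ℤ) ≠ 0 by norm_num)
    linear_combination -h4
  have hT := BinQF.properEquiv_T (⟨((243 : ℕ) : ℤ), B, c⟩ : BinQF) ((216 * (t : ℤ) ^ 2 + 217 * t + 55) + 1)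
  have hform : (⟨((243 : ℕ) : ℤ), B + 2 * ((243 : ℕ) : ℤ) * ((216 * (t : ℤ) ^ 2 + 217 * t + 55) + 1),
      ((243 : ℕ) : ℤ) * ((216 * (t : ℤ) ^ 2 + 217 * t + 55) + 1) ^ 2 + B * ((216 * (t : ℤ) ^ 2 + 217 * t + 55) + 1) + c⟩ :
        BinQF) = ⟨((243 : ℕ) : ℤ), ((243 : ℕ) : ℤ), 729 * (t : ℤ) ^ 2 + 675 * t + 217⟩ := by
    simp only [BinQF.mk.injEq]
    refine ⟨trivial, ?_, ?_⟩
    · rw [hBj]; push_cast; ring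
    · rw [hc_eq, hBj]; push_cast; ring
  have hT' : (⟨((243 : ℕ) : ℤ), B, c⟩ : BinQF).ProperEquiv ⟨((243 : ℕ) : ℤ), ((243 : ℕ) : ℤ), 729 * (t : ℤ) ^ 2 + 675 * t + 217⟩ := by
    have h := hT
    simp only at h
    rw [hform] at h
    exact h
  have hred' : (⟨((243 : ℕ) : ℤ), ((243 : ℕ) : ℤ), 729 * (t : ℤ) ^ 2 + 675 * t + 217⟩ : BinQF).IsPosPrim Δ.D :=
    hT'.isPosPrim Δ.neg hn
  have hcl : classOf' Δ ⟨((243 : ℕ) : ℤ), B, c⟩ =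
      classOf' Δ ⟨((243 : ℕ) : ℤ), ((243 : ℕ) : ℤ), 729 * (t : ℤ) ^ 2 + 675 * t + 217⟩ :=
    (classOf'_eq_classOf'_iff_properEquiv Δ hn hred').mpr hT'
  rw [hcl]
  -- compare with the principal reduced form
  have hD4 : Δ.D % 4 = 0 ∨ Δ.D % 4 = 1 := by
    right
    have hD : Δ.D = 4 * (-(177147 * (t : ℤ) ^ 2) - 164025 * t - 37969) + 1 := by rw [hΔ]; push_cast; ring
    omega
  rw [Ne, ← classOf'_one Δ hD4]
  intro h
  have ht0 : (1 : ℤ) ≤ t := by exact_mod_cast ht1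
  have hred : (⟨((243 : ℕ) : ℤ), ((243 : ℕ) : ℤ), 729 * (t : ℤ) ^ 2 + 675 * t + 217⟩ : BinQF).IsReduced := by
    refine ⟨?_, ?_, ?_⟩
    · show |(((243 : ℕ) : ℤ))| ≤ ((243 : ℕ) : ℤ)
      simp
    · show (((243 : ℕ) : ℤ)) ≤ 729 * (t : ℤ) ^ 2 + 675 * t + 217
      push_cast
      nlinarith
    · intro _
      show (0 : ℤ) ≤ ((243 : ℕ) : ℤ)
      positivity
  have hone := FormComposition.isPosPrim_one Δ.neg hD4
  have heq := classOf'_inj Δ hred' hone.1 hred hone.2 h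
  have ha := congrArg BinQF.a heq
  rw [FormComposition.one_a] at ha
  norm_num at ha

end Summit.BirchSwinnertonDyer.BirchSwinnertonDyer.Theorems.SylvesterTwoLevelFixingClass

end
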